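import Literature.AlgebraicGeometry.HodgeTheory.WeilOperatorDegreeOne
import Literature.AlgebraicGeometry.HodgeTheory.HyperbolicWeilTypeBalanced
import Literature.AlgebraicGeometry.HodgeTheory.HodgeRiemannDegreeOneSigns
import Literature.AlgebraicGeometry.HodgeTheory.WeilClassesDescendingAssembly
import Literature.AlgebraicGeometry.HodgeTheory.WeilClassesDescendingTransfer
import Literature.AlgebraicGeometry.HodgeTheory.GysinFormalismHodgeOfGysin
import Literature.AlgebraicGeometry.HodgeTheory.HodgeTypeVanishing
import Literature.AlgebraicGeometry.HodgeTheory.HodgeRiemannPolarizabilityProofs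
import Literature.AlgebraicGeometry.Motives.RationalDegreeOneModel
import Literature.AlgebraicGeometry.Motives.RationalDegreeOneModelWeilType
import Literature.AlgebraicGeometry.Motives.AbelianVarietyCohomologyExteriorH1
import Literature.LinearAlgebra.QuadraticForm.PositiveProjections
import Mathlib.Topology.Algebra.Module.FiniteDimension
import HarnessLib

/-!
# The period point of an abelian variety of Weil type lies in Deligne's domain `X⁺`

Family `hodge`, layer `Literature/AlgebraicGeometry/HodgeTheory`; definitions with bodies and
theorems, no named fact (D-0026). In the proof of [Deligne1982HodgeCycles, Thm. 4.8] (LNM 900,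
pp. 48–50) the family of abelian varieties is parametrised by the Hermitian symmetric domain
`X⁺` of complex structures `J` on `V = H₁(A, ℝ)` that are `E ⊗ ℝ`-linear, preserve the Riemann
form `ψ` and are positive for it ("(a′) … (b′) …", p. 48), and `X⁺` is "the connected component
containing the complex structure of `A`". The tree has `X⁺` as
`LinearAlgebra.QuadraticForm.posComplexStructures k ψ = {J | J² = -1, Jk = kJ, ψ(Jx, Jy) = ψ(x, y),
ψ(x, Jx) > 0}` (proved connected, contractible, with free properly discontinuous arithmetic
action: `PosComplexStructures*`). THIS file supplies the point of `X⁺` defined by an actual abelian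
variety of Weil type, on the tree's cohomological carriers: for a complex abelian variety `A` of
dimension `m + 1 ≥ 2` with `φ ≫ φ = -d` (`d ≥ 1`), a projective embedding `e` and a non-zero
rational `a ∈ H²(ℙᴺ(ℂ); ℂ)`, put `h_K = d·e^*a + φ^*e^*a` (the `K`-symmetrised hyperplane class of
the Weil-family facts `weilFamilyReach_hyperbolic`, `weilFamily_hyperbolic_weilSystem_reach`),
`Q(x, y) = Q_{h_K}(x, y) = h_K^m ⌣ x ⌣ y ∈ H^{2m+2}(A(ℂ); ℂ) ≅ ℂ` (`Motives.polarizationPairingOne`),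
`k = φ^*` and `C` the Weil operator of `H¹(A(ℂ); ℂ)` (`weilOperatorOne`, `i` on `H^{1,0}`, `-i` on
`H^{0,1}`; `HodgeTheory/WeilOperatorDegreeOne`). Then (Deligne's (a′), (b′) and positivity, read
on `H¹` instead of `H₁`):

* `polarizationPairingOne_weilOperatorOne` — **`Q(Cx, Cy) = Q(x, y)`** for every class `h` of
  type `(1,1)` on a smooth projective `X` of dimension `j + 1` (`Q(H^{1,0}, H^{1,0}) = 0 =
  Q(H^{0,1}, H^{0,1})`: the products have types `(j+2, j)`, `(j, j+2)` in degree `2j + 2`, zero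
  for dimension reasons — `isOfHodgeType_cupPowTwo`, `polarizationPairingOne_eq_zero_of_mem_hodgeOneZero`);
* `commute_weilOperatorOne_map` (from `WeilOperatorDegreeOne`) — **`C k = k C`**; and
  `complexBetti_map_map_one_of_comp_self` (tree) — **`k² = -d`**;
* `polarizationPairingOne_map_map_ksymm` — **`Q(kx, ky) = d · Q(x, y)`** (van Geemen's
  `(√-d)^* E = d E`: `φ^* h_K = d h_K`, naturality of `Q`, and `φ^* = d^{m+1}` on the top
  cohomology, the tree's `Motives.map_top_eq_pow_smul`), equivalently
  `polarizationPairingOne_map_left_ksymm` — **`Q(kx, y) = -Q(x, ky)`**;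
* `polarizationPairingOne_swap`, `polarizationPairingOne_self` — `Q` is alternating;
  `conjClass_polarizationPairingOne` — `Q` is real for a rational `h`;
* `exists_pos_polarizationPairingOne_weilOperatorOne` — **POSITIVITY**: there is a non-zero
  RATIONAL generator `ω₀` of the line `H^{2m+2}(A(ℂ); ℂ)` such that `Q(x, Cx) = t·ω₀` with
  `t > 0` for every non-zero REAL class `x` (`\overline{x} = x`). Proof: `h_K = s·H'` with `H'`
  Kähler and `s ∈ ℝˣ` (as in `HyperbolicWeilTypeBalanced`), Hodge–Riemann in degree one for `H'`
  (`IsKaehlerClass.hodgeRiemann_one_smul`: `i·τ(z ⌣ z̄ ⌣ h_K^m) > 0` on `H^{1,0} ∖ 0`), and for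
  real `x = z + z̄`, `z = π^{1,0}x ≠ 0`: `Q(x, Cx) = -2i·Q(z, z̄)`; the coefficient along a
  rational generator is real because `Q(x, Cx)` is a real class.

Real side (`H¹(X(ℂ); ℝ) = singularCohomology ℝ ℝ X(ℂ) 1`, the tree's real structure
`ofRealClass` / `reClass` of `HodgeTheory/RealStructureSingular`): `realWeilOperatorOne` (**`J`**, the
restriction of `C`; `ofRealClass_realWeilOperatorOne`), `realMapOne` (**`k = g^*`** with real
coefficients), `realPolarizationForm h j ℓ` (**`ψ = Re ℓ ∘ Q_h`** for a functional `ℓ` on the top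
cohomology; with the tree's coordinate functional `lineCoord` along a rational generator, `ψ` is
rational on the rational lattice, `exists_realPolarizationForm_lineCoord_eq_ratCast`); and for `(A, φ, h_K)`:
`realWeilOperatorOne_mul_self` (`J² = -1`), `commute_realWeilOperatorOne_realMapOne` (`Jk = kJ`),
`realMapOne_mul_self_of_comp_self` (`k² = -d`), `isAlt_realPolarizationForm`,
`realPolarizationForm_realMapOne_left_ksymm` (`ψ(kx, y) = -ψ(x, ky)`),
`realPolarizationForm_realWeilOperatorOne_ksymm` (`ψ(Jx, Jy) = ψ(x, y)`) and
`exists_pos_realPolarizationForm_realWeilOperatorOne` (**`ψ(x, Jx) > 0`** for every `ℓ` positive on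
the oriented generator). Finally `periodPoint_mem_posComplexStructures`: on every finite-dimensional
normed model `g : W ≃ H¹(A(ℂ); ℝ)` the transported `J` is a MEMBER of the tree's
`LinearAlgebra.QuadraticForm.posComplexStructures (g⁻¹kg) (ψ ∘ (g × g))`, together with the standing
hypotheses `hk`, `hψk`, `hψ` of `PosComplexStructuresConnected` — the period point of `(A, φ, h_K)`
is a point of Deligne's `X⁺`. What is NOT here: the family over `X⁺`, the uniformisation
`A(ℂ) = V/Λ`, Riemann's theorem.

## References

* [Deligne1982HodgeCycles] P. Deligne (notes by J. S. Milne), Hodge cycles on abelian varieties,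
  in: Hodge Cycles, Motives, and Shimura Varieties, LNM 900 (1982), §1 (p. 11), 4.7, proof of
  Thm. 4.8 (pp. 48–50: (a′), (b′), `X⁺`).
* [vanGeemen1994HodgeAV] B. van Geemen, An introduction to the Hodge conjecture for abelian
  varieties, LNM 1594 (1994), 4.9, Lemma 5.2 (1)–(2) and proof (p. 221: `E(x, Jx) > 0`,
  `(√-d)^* E = d E`).
* [VoisinHodgeI2002] C. Voisin, Hodge Theory and Complex Algebraic Geometry I (CUP 2002), §6.1.3,
  Thm. 6.32, §7.1.2.
* [LangeBirkenhake1992] H. Lange, Ch. Birkenhake, Complex Abelian Varieties (1992), Prop. 1.1.9,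
  Lemma 1.1.17, Thm. 4.2.1.
-/

noncomputable section

open scoped Manifold ContDiff
open CategoryTheory AlgebraicGeometry
open Literature.AlgebraicTopology.SingularHomology Literature.Geometry.Kaehler
open Literature.NumberTheory.Transcendental
open Literature.AlgebraicGeometry.Motives (projectiveSpace ComplexPoints IsSmoothProjective
  polarizationPairingOne AbelianVariety ProjectiveEmbedding)
open Literature.AlgebraicGeometry.Motives.AnalytificationKaehler (fubiniStudyPullbackForm)

namespace Literature.AlgebraicGeometry.HodgeTheory

section HodgeTheory

/-! ### The polarization pairing of a `(1,1)`-class: types, alternation, reality -/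

section Pairing

variable {n : ℕ} {X : Motives.SchemeOver ℂ}

/-- **`hʲ` is of type `(j, j)`** for a class `h` of type `(1, 1)` on a smooth projective `X`
(`1` is of type `(0,0)`; the cup product adds Hodge types, `CupPreservesHodgeType`).
[cite: VoisinHodgeI2002, §7.1.2 and Thm. 5.29] -/
theorem isOfHodgeType_cupPowTwo (hX : IsSmoothProjective n X) {h : complexBetti X 2}
    (hh : IsOfHodgeType n X 2 1 1 h) (j : ℕ) : IsOfHodgeType n X (2 * j) j j (cupPowTwo h j) := by
  have hcup : CupPreservesHodgeType n X :=
    cupPreservesHodgeType_of_multiplicative_deRham (fun E _ _ _ ↦ exists_deRhamIsoFamily_holds E) hX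
  obtain ⟨M⟩ := nonempty_hodgeModel_holds.nonempty hX
  induction j with
  | zero => exact isOfHodgeType_zero_zero_zero M _
  | succ j ih =>
    rw [cupPowTwo_succ]
    exact hcup (two_mul_add_two j) ih hh

/-- **`Q_h(z, z') = 0` for `z, z' ∈ H^{1,0}`**, `h` of type `(1,1)`, `dim X = j + 1`: the class
`z ⌣ z' ⌣ hʲ` is of type `(j + 2, j)`, and `j + 2 > dim X`. (Deligne's condition (a′)/(b′) read on
`H¹`: the Riemann form is of type `(1,1)`, i.e. vanishes on `H^{1,0} ⊗ H^{1,0}`.)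
[cite: Deligne1982HodgeCycles, proof of Thm. 4.8, p. 48 (a′)] [cite: VoisinHodgeI2002, §7.1.2] -/
theorem polarizationPairingOne_eq_zero_of_mem_hodgeOneZero {j : ℕ} (hX : IsSmoothProjective (j + 1) X)
    {h : complexBetti X 2} (hh : IsOfHodgeType (j + 1) X 2 1 1 h) {z z' : complexBetti X 1}
    (hz : z ∈ hodgeOneZero hX) (hz' : z' ∈ hodgeOneZero hX) : polarizationPairingOne X h j z z' = 0 := by
  have hcup : CupPreservesHodgeType (j + 1) X :=
    cupPreservesHodgeType_of_multiplicative_deRham (fun E _ _ _ ↦ exists_deRhamIsoFamily_holds E) hX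
  rw [polarizationPairingOne_eq_cupProduct_cupPowTwo]
  have h1 := hcup rfl ((mem_hodgeOneZero hX).1 hz') (isOfHodgeType_cupPowTwo hX hh j)
  have h2 := hcup (show 1 + (1 + 2 * j) = 2 + 2 * j by omega) ((mem_hodgeOneZero hX).1 hz) h1
  exact IsOfHodgeType.eq_zero_of_lt hX h2 (Or.inl (by omega))

/-- **`Q_h(w, w') = 0` for `w, w' ∈ H^{0,1}`** (type `(j, j + 2)`).
[cite: Deligne1982HodgeCycles, proof of Thm. 4.8, p. 48 (a′)] [cite: VoisinHodgeI2002, §7.1.2] -/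
theorem polarizationPairingOne_eq_zero_of_mem_hodgeZeroOne {j : ℕ} (hX : IsSmoothProjective (j + 1) X)
    {h : complexBetti X 2} (hh : IsOfHodgeType (j + 1) X 2 1 1 h) {w w' : complexBetti X 1}
    (hw : w ∈ hodgeZeroOne hX) (hw' : w' ∈ hodgeZeroOne hX) : polarizationPairingOne X h j w w' = 0 := by
  have hcup : CupPreservesHodgeType (j + 1) X :=
    cupPreservesHodgeType_of_multiplicative_deRham (fun E _ _ _ ↦ exists_deRhamIsoFamily_holds E) hX
  rw [polarizationPairingOne_eq_cupProduct_cupPowTwo]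
  have h1 := hcup rfl ((mem_hodgeZeroOne hX).1 hw') (isOfHodgeType_cupPowTwo hX hh j)
  have h2 := hcup (show 1 + (1 + 2 * j) = 2 + 2 * j by omega) ((mem_hodgeZeroOne hX).1 hw) h1
  exact IsOfHodgeType.eq_zero_of_lt hX h2 (Or.inr (by omega))

/-- **The Weil operator preserves the polarization pairing of a `(1,1)`-class:
`Q_h(Cx, Cy) = Q_h(x, y)`** (Deligne's (b′): `ψ(Jx, Jy) = ψ(x, y)`). With `x = a + b`, `y = a' + b'`
in `H^{1,0} ⊕ H^{0,1}`: both sides equal `Q(a, b') + Q(b, a')`, since `Q(a, a') = Q(b, b') = 0`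
and `i · (-i) = 1`. [cite: Deligne1982HodgeCycles, proof of Thm. 4.8, p. 48 (b′)]
[cite: vanGeemen1994HodgeAV, Lemma 5.2 (1)] -/
theorem polarizationPairingOne_weilOperatorOne {j : ℕ} (hX : IsSmoothProjective (j + 1) X)
    {h : complexBetti X 2} (hh : IsOfHodgeType (j + 1) X 2 1 1 h) (x y : complexBetti X 1) :
    polarizationPairingOne X h j (weilOperatorOne hX x) (weilOperatorOne hX y) =
      polarizationPairingOne X h j x y := by
  set Q := polarizationPairingOne X h j with hQ
  have hx := projOneZero_add_projZeroOne hX x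
  have hy := projOneZero_add_projZeroOne hX y
  have haa : Q (projOneZero hX x) (projOneZero hX y) = 0 :=
    polarizationPairingOne_eq_zero_of_mem_hodgeOneZero hX hh (projOneZero_mem hX x) (projOneZero_mem hX y)
  have hbb : Q (projZeroOne hX x) (projZeroOne hX y) = 0 :=
    polarizationPairingOne_eq_zero_of_mem_hodgeZeroOne hX hh (projZeroOne_mem hX x) (projZeroOne_mem hX y)
  conv_rhs => rw [← hx, ← hy]
  rw [weilOperatorOne_apply, weilOperatorOne_apply]
  simp only [map_sub, map_add, map_smul, LinearMap.sub_apply, LinearMap.add_apply,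
    LinearMap.smul_apply, haa, hbb, smul_zero, zero_sub, sub_zero, zero_add, add_zero]
  simp only [smul_neg, smul_smul, Complex.I_mul_I, neg_one_smul, neg_neg, sub_neg_eq_add]

/-- **`Q_h` is anticommutative in degree one**: `Q_h(y, x) = -Q_h(x, y)` (graded commutativity of
the cup product, Hatcher Thm. 3.11). [cite: HatcherAT2002, Thm. 3.11] -/
theorem polarizationPairingOne_swap (h : complexBetti X 2) (j : ℕ) (x y : complexBetti X 1) :
    polarizationPairingOne X h j y x = -polarizationPairingOne X h j x y := by
  rw [Motives.polarizationPairingOne_apply, Motives.polarizationPairingOne_apply,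
    cupProduct_gradedComm_holds (R := ℂ) (X := ComplexPoints X) rfl rfl y x, map_smul, pow_one,
    neg_one_smul]

/-- **`Q_h(x, x) = 0`** (alternation; characteristic zero). [cite: HatcherAT2002, Thm. 3.11] -/
theorem polarizationPairingOne_self (h : complexBetti X 2) (j : ℕ) (x : complexBetti X 1) :
    polarizationPairingOne X h j x x = 0 := by
  have h2 := polarizationPairingOne_swap h j x x
  rw [eq_neg_iff_add_eq_zero, ← two_smul ℂ] at h2
  exact (smul_eq_zero.1 h2).resolve_left two_ne_zero

/-- **`Q_h` is real for a rational `h`**: `\overline{Q_h(x, y)} = Q_h(\overline{x}, \overline{y})`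
(conjugation is multiplicative, `conjClass_cupProduct`, and fixes the rational `hʲ`).
[cite: VoisinHodgeI2002, §6.1.3 Cor. 6.12] -/
theorem conjClass_polarizationPairingOne {h : complexBetti X 2} (hh : IsRationalClass h) (j : ℕ)
    (x y : complexBetti X 1) :
    conjClass (ComplexPoints X) (2 + 2 * j) (polarizationPairingOne X h j x y) =
      polarizationPairingOne X h j (conjClass (ComplexPoints X) 1 x) (conjClass (ComplexPoints X) 1 y) := by
  rw [polarizationPairingOne_eq_cupProduct_cupPowTwo, polarizationPairingOne_eq_cupProduct_cupPowTwo,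
    conjClass_cupProduct, conjClass_cupProduct, (hh.cupPowTwo j).conjClass_eq]

/-- **For a real class `x = z + \overline{z}` (`z = π^{1,0} x`): `Q_h(x, Cx) = -2i · Q_h(z, \overline{z})`**
(`Cx = iz - i\overline{z}`, `Q` bilinear and alternating). This is the identity
`E(x, Jx) = -2i E(z, z̄)` behind "the second Riemann condition" on `H¹`.
[cite: vanGeemen1994HodgeAV, proof of Lemma 5.2 (p. 221)] [cite: VoisinHodgeI2002, Thm. 6.32] -/
theorem polarizationPairingOne_self_weilOperatorOne_of_conjClass_eq (hX : IsSmoothProjective n X)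
    (h : complexBetti X 2) (j : ℕ) {x : complexBetti X 1} (hx : conjClass (ComplexPoints X) 1 x = x) :
    polarizationPairingOne X h j x (weilOperatorOne hX x) =
      (-2 * Complex.I) • polarizationPairingOne X h j (projOneZero hX x)
        (conjClass (ComplexPoints X) 1 (projOneZero hX x)) := by
  obtain ⟨z, hz⟩ : ∃ z, projOneZero hX x = z := ⟨_, rfl⟩
  have hxz : z + conjClass (ComplexPoints X) 1 z = x := by
    rw [← hz]; exact projOneZero_add_conjClass_projOneZero hX hx
  have hC : weilOperatorOne hX x = Complex.I • z - Complex.I • conjClass (ComplexPoints X) 1 z := by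
    rw [weilOperatorOne_of_conjClass_eq hX hx, hz]
  rw [hC, hz]
  conv_lhs => rw [← hxz]
  set Q := polarizationPairingOne X h j with hQ
  have hzz : Q z z = 0 := polarizationPairingOne_self h j z
  have hcc : Q (conjClass (ComplexPoints X) 1 z) (conjClass (ComplexPoints X) 1 z) = 0 :=
    polarizationPairingOne_self h j _
  have hcz : Q (conjClass (ComplexPoints X) 1 z) z = -Q z (conjClass (ComplexPoints X) 1 z) :=
    polarizationPairingOne_swap h j _ _
  simp only [map_add, map_sub, map_smul, LinearMap.add_apply, hzz, hcc, hcz, zero_add, add_zero,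
    smul_neg, mul_smul]
  rw [show (-2 : ℂ) = -1 + -1 by norm_num, add_smul, neg_one_smul]
  abel

end Pairing

/-! ### The abelian variety of Weil type: `h_K`, `K`-compatibility, positivity -/

section WeilType

variable {m d : ℕ} {A : AbelianVariety ℂ}

/-- **`h_K = d·e^*a + φ^*e^*a` is a non-zero real multiple of a Kähler class**: `e^*a = s·H_K` with
`H_K` the class of the restricted Fubini–Study metric and `s ∈ ℝˣ`
(`exists_real_map_eq_smul_of_pullback_eq_fubiniStudy`), and `H' = d·H_K + φ^*H_K` is Kähler
(`IsKaehlerClassVia.natCast_smul_add_map`); `h_K = s·H'`. (The model-building steps of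
`HyperbolicWeilTypeBalanced`, isolated.) [cite: VoisinHodgeI2002, §3.1.3, §3.3.2 and §7.1.2] -/
theorem exists_isKaehlerClass_ksymm_eq_smul (hA : A.dim = m + 1) (hd : 0 < d) (φ : A ⟶ A)
    (e : ProjectiveEmbedding A.X) {a : complexBetti (projectiveSpace e.n ℂ) 2} (ha : IsRationalClass a)
    (ha0 : a ≠ 0) :
    ∃ (s : ℝ) (H' : complexBetti A.X 2), s ≠ 0 ∧ IsKaehlerClass (m + 1) A.X H' ∧
      (d : ℂ) • complexBetti.map e.ι 2 a + complexBetti.map φ.hom.hom.hom 2 (complexBetti.map e.ι 2 a) =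
        (s : ℂ) • H' := by
  have hX : IsSmoothProjective (m + 1) A.X := Motives.isSmoothProjective_of_dim_eq' hA
  obtain ⟨M⟩ := nonempty_hodgeModel_holds.nonempty hX
  obtain ⟨eR, heR, hem, -⟩ := exists_deRhamIsoFamily_holds M.model
  have hθ := M.fubiniStudyPullbackForm_mem_closedSmoothForms e.ι
  obtain ⟨HK, hHK⟩ := M.pullback_surjective 2 (ofRealClass M.carrier 2 (eR M.carrier 2
    (deRhamCohomology.mk ⟨fubiniStudyPullbackForm M.model e.ι M.toComplexPoints, hθ⟩)))
  have hKvia : M.IsKaehlerClassVia eR HK :=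
    M.isKaehlerClassVia_of_pullback_eq_fubiniStudyPullbackForm eR hX e.ι hθ hHK
  obtain ⟨s, hs0, hsa⟩ := exists_real_map_eq_smul_of_pullback_eq_fubiniStudy hX (by omega) M
    e.ι eR heR hθ hHK ha ha0
  refine ⟨s, (d : ℂ) • HK + complexBetti.map φ.hom.hom.hom 2 HK, hs0,
    (hKvia.natCast_smul_add_map heR hX φ.hom.hom.hom hd).isKaehlerClass heR hem, ?_⟩
  rw [hsa, map_smul, smul_comm (d : ℂ) (s : ℂ) HK, smul_add]

/-- **`h_K` is of Hodge type `(1, 1)`** (a real multiple of a Kähler class).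
[cite: VoisinHodgeI2002, §3.1.1 Lemma 3.3 and §7.1.2] -/
theorem isOfHodgeType_one_one_ksymm (hA : A.dim = m + 1) (hd : 0 < d) (φ : A ⟶ A)
    (e : ProjectiveEmbedding A.X) {a : complexBetti (projectiveSpace e.n ℂ) 2} (ha : IsRationalClass a)
    (ha0 : a ≠ 0) :
    IsOfHodgeType (m + 1) A.X 2 1 1
      ((d : ℂ) • complexBetti.map e.ι 2 a + complexBetti.map φ.hom.hom.hom 2 (complexBetti.map e.ι 2 a)) := by
  obtain ⟨s, H', -, hK', hh⟩ := exists_isKaehlerClass_ksymm_eq_smul hA hd φ e ha ha0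
  rw [hh]
  exact hK'.isOfHodgeType_one_one.smul _

/-- **`h_K` is rational** (`a` is). [cite: HatcherAT2002, §3.1 Thm. 3.2 and p. 198] -/
theorem isRationalClass_ksymm (d : ℕ) (φ : A ⟶ A) (e : ProjectiveEmbedding A.X)
    {a : complexBetti (projectiveSpace e.n ℂ) 2} (ha : IsRationalClass a) :
    IsRationalClass
      ((d : ℂ) • complexBetti.map e.ι 2 a + complexBetti.map φ.hom.hom.hom 2 (complexBetti.map e.ι 2 a)) := by
  have h1 : IsRationalClass (complexBetti.map e.ι 2 a) := ha.pullback _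
  have h2 := h1.smul (d : ℚ)
  rw [Rat.cast_natCast] at h2
  exact h2.add (h1.pullback _)

/-- **`Q_{h_K}(Cx, Cy) = Q_{h_K}(x, y)`**: the Weil operator of `H¹(A(ℂ); ℂ)` preserves the
polarization pairing of the `K`-symmetrised hyperplane class (Deligne's (b′) for the period point
of `A`). [cite: Deligne1982HodgeCycles, proof of Thm. 4.8, p. 48 (b′)] [cite: vanGeemen1994HodgeAV, Lemma 5.2 (1)] -/
theorem polarizationPairingOne_weilOperatorOne_ksymm (hA : A.dim = m + 1) (hd : 0 < d) (φ : A ⟶ A)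
    (e : ProjectiveEmbedding A.X) {a : complexBetti (projectiveSpace e.n ℂ) 2} (ha : IsRationalClass a)
    (ha0 : a ≠ 0) (x y : complexBetti A.X 1) :
    polarizationPairingOne A.X
        ((d : ℂ) • complexBetti.map e.ι 2 a + complexBetti.map φ.hom.hom.hom 2 (complexBetti.map e.ι 2 a)) m
        (weilOperatorOne (Motives.isSmoothProjective_of_dim_eq' hA) x)
        (weilOperatorOne (Motives.isSmoothProjective_of_dim_eq' hA) y) =
      polarizationPairingOne A.X
        ((d : ℂ) • complexBetti.map e.ι 2 a + complexBetti.map φ.hom.hom.hom 2 (complexBetti.map e.ι 2 a)) m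
        x y :=
  polarizationPairingOne_weilOperatorOne (Motives.isSmoothProjective_of_dim_eq' hA)
    (isOfHodgeType_one_one_ksymm hA hd φ e ha ha0) x y

/-- **`K`-compatibility of the polarization: `Q_{h_K}(φ^*x, φ^*y) = d · Q_{h_K}(x, y)`** for
`φ ≫ φ = -d`, `d ≥ 1` (van Geemen: `(√-d)^* E = d E`). Proof: `φ^* h_K = d h_K`
(`map_ksymm_eq_smul`), naturality `φ^* Q_h(x, y) = Q_{φ^*h}(φ^*x, φ^*y)` and
`Q_{d h} = d^m Q_h`, while `φ^*` is the scalar `d^{m+1}` on the top cohomology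
(`Motives.map_top_eq_pow_smul`, the degree of `φ`; `H• = ⋀• H¹` is the tree's theorem
`abelianVarietyCohomologyExteriorH1_holds`). [cite: vanGeemen1994HodgeAV, 4.9 and Lemma 5.2 (2)]
[cite: Deligne1982HodgeCycles, proof of Thm. 4.8, p. 48 (a′)] -/
theorem polarizationPairingOne_map_map_ksymm (hA : A.dim = m + 1) (hd : 0 < d) {φ : A ⟶ A}
    (hφ : φ ≫ φ = -(d • 𝟙 A)) (e : ProjectiveEmbedding A.X) (a : complexBetti (projectiveSpace e.n ℂ) 2)
    (x y : complexBetti A.X 1) :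
    polarizationPairingOne A.X
        ((d : ℂ) • complexBetti.map e.ι 2 a + complexBetti.map φ.hom.hom.hom 2 (complexBetti.map e.ι 2 a)) m
        (complexBetti.map φ.hom.hom.hom 1 x) (complexBetti.map φ.hom.hom.hom 1 y) =
      (d : ℂ) • polarizationPairingOne A.X
        ((d : ℂ) • complexBetti.map e.ι 2 a + complexBetti.map φ.hom.hom.hom 2 (complexBetti.map e.ι 2 a)) m
        x y := by
  set hK := (d : ℂ) • complexBetti.map e.ι 2 a + complexBetti.map φ.hom.hom.hom 2 (complexBetti.map e.ι 2 a)
    with hKdef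
  have hrank := Motives.abelianVarietyCohomologyExteriorH1.finrank_one
    Motives.abelianVarietyCohomologyExteriorH1_holds A
  have hspan := Motives.abelianVarietyCohomologyExteriorH1.span_range_cupPowOne
    Motives.abelianVarietyCohomologyExteriorH1_holds A (2 + 2 * m)
  have hh : complexBetti.map φ.hom.hom.hom 2 hK = (d : ℂ) • hK := map_ksymm_eq_smul hφ _
  have e2 := Motives.map_polarizationPairingOne φ.hom.hom.hom hK m x y
  rw [hh, Motives.polarizationPairingOne_smul,
    Motives.map_top_eq_pow_smul hA hrank hspan hd hφ, pow_succ, mul_smul] at e2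
  have hd0 : ((d : ℂ) ^ m) ≠ 0 := pow_ne_zero _ (Nat.cast_ne_zero.2 hd.ne')
  exact (smul_right_injective _ hd0 e2).symm

/-- **Skew form of the `K`-compatibility: `Q_{h_K}(φ^*x, y) = -Q_{h_K}(x, φ^*y)`** (from
`Q(φ^*x, φ^*y) = d Q(x, y)` and `(φ^*)² = -d`: replace `y` by `φ^*y`). This is the standing
hypothesis `hψk` of `LinearAlgebra.QuadraticForm.PosComplexStructuresConnected`.
[cite: vanGeemen1994HodgeAV, 4.9 and Lemma 5.2 (2)] [cite: Deligne1982HodgeCycles, proof of Thm. 4.8, p. 48 (a′)] -/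
theorem polarizationPairingOne_map_left_ksymm (hA : A.dim = m + 1) (hd : 0 < d) {φ : A ⟶ A}
    (hφ : φ ≫ φ = -(d • 𝟙 A)) (e : ProjectiveEmbedding A.X) (a : complexBetti (projectiveSpace e.n ℂ) 2)
    (x y : complexBetti A.X 1) :
    polarizationPairingOne A.X
        ((d : ℂ) • complexBetti.map e.ι 2 a + complexBetti.map φ.hom.hom.hom 2 (complexBetti.map e.ι 2 a)) m
        (complexBetti.map φ.hom.hom.hom 1 x) y =
      -polarizationPairingOne A.X
        ((d : ℂ) • complexBetti.map e.ι 2 a + complexBetti.map φ.hom.hom.hom 2 (complexBetti.map e.ι 2 a)) m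
        x (complexBetti.map φ.hom.hom.hom 1 y) := by
  set Q := polarizationPairingOne A.X
    ((d : ℂ) • complexBetti.map e.ι 2 a + complexBetti.map φ.hom.hom.hom 2 (complexBetti.map e.ι 2 a)) m
    with hQ
  have hd0 : (d : ℂ) ≠ 0 := Nat.cast_ne_zero.2 hd.ne'
  -- `Q(φ^*x, φ^*(φ^*y)) = d Q(x, φ^*y)` and `φ^*(φ^*y) = -d y`
  have h1 := polarizationPairingOne_map_map_ksymm hA hd hφ e a x (complexBetti.map φ.hom.hom.hom 1 y)
  have h2 : complexBetti.map φ.hom.hom.hom 1 (complexBetti.map φ.hom.hom.hom 1 y) = -((d : ℂ) • y) :=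
    complexBetti_map_map_one_of_comp_self hφ y
  rw [h2, map_neg, map_smul] at h1
  rw [← hQ] at h1
  have h3 : (d : ℂ) • Q (complexBetti.map φ.hom.hom.hom 1 x) y =
      (d : ℂ) • -Q x (complexBetti.map φ.hom.hom.hom 1 y) := by
    rw [smul_neg, ← h1, neg_neg]
  exact smul_right_injective _ hd0 h3

/-- Transport of a linear functional on `H^{1+(1+2m)}` to the degree spelling `k` (the target degree
of `cupProduct` is a free name). [folklore] -/
private theorem exists_functional_degree_eq {X : Motives.SchemeOver ℂ} {j k : ℕ} (hk : 1 + (1 + 2 * j) = k)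
    (τ : complexBetti X (1 + (1 + 2 * j)) →ₗ[ℂ] ℂ) :
    ∃ τ' : complexBetti X k →ₗ[ℂ] ℂ, ∀ (z : complexBetti X 1) (w : complexBetti X (1 + 2 * j)),
      τ' (cupProduct hk z w) = τ (cupProduct rfl z w) := by
  subst hk
  exact ⟨τ, fun _ _ ↦ rfl⟩

/-- **Positivity of the period point (the second Riemann condition on `H¹`).** Let `A` be a complex
abelian variety of dimension `m + 1 ≥ 2`, `φ : A ⟶ A`, `d ≥ 1`, `e` a projective embedding and
`a ∈ H²(ℙᴺ(ℂ); ℂ)` rational and non-zero; `h_K = d·e^*a + φ^*e^*a`, `C` the Weil operator of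
`H¹(A(ℂ); ℂ)`. Then there is a non-zero RATIONAL class `ω₀` spanning the line `H^{2m+2}(A(ℂ); ℂ)`
such that for every non-zero REAL class `x` (`\overline{x} = x`):
`Q_{h_K}(x, Cx) = h_K^m ⌣ x ⌣ Cx = t · ω₀` with `t > 0`. Proof: `h_K = s·H'`, `H'` Kähler, `s ≠ 0`
real; Hodge–Riemann in degree one (`i · τ(z ⌣ z̄ ⌣ h_K^m) > 0` for `z ∈ H^{1,0} ∖ 0`, Voisin I
Thm. 6.32, the tree's `IsKaehlerClass.hodgeRiemann_one_smul`); for real `x`,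
`Q(x, Cx) = -2i Q(z, z̄)` with `z = π^{1,0}x ≠ 0`; the coefficient of the real class `Q(x, Cx)` along
a rational generator is real (`im_eq_zero_of_smul_eq_of_conjClass_eq`), of a sign independent of
`x`, absorbed into `ω₀`. This is Deligne's "`ψ(x, Jy)` positive definite" / van Geemen's
`E(x, Jx) > 0` for the period point of `(A, h_K)`.
[cite: Deligne1982HodgeCycles, proof of Thm. 4.8, p. 48] [cite: vanGeemen1994HodgeAV, proof of Lemma 5.2 (p. 221)]
[cite: VoisinHodgeI2002, Thm. 6.32 and §7.1.2] -/
theorem exists_pos_polarizationPairingOne_weilOperatorOne (hm : 1 ≤ m) (hA : A.dim = m + 1) (hd : 0 < d)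
    (φ : A ⟶ A) (e : ProjectiveEmbedding A.X) {a : complexBetti (projectiveSpace e.n ℂ) 2}
    (ha : IsRationalClass a) (ha0 : a ≠ 0) :
    ∃ ω₀ : complexBetti A.X (2 + 2 * m), IsRationalClass ω₀ ∧ ω₀ ≠ 0 ∧
      ∀ x : complexBetti A.X 1, conjClass (ComplexPoints A.X) 1 x = x → x ≠ 0 →
        ∃ t : ℝ, 0 < t ∧
          polarizationPairingOne A.X
              ((d : ℂ) • complexBetti.map e.ι 2 a + complexBetti.map φ.hom.hom.hom 2 (complexBetti.map e.ι 2 a)) m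
              x (weilOperatorOne (Motives.isSmoothProjective_of_dim_eq' hA) x) = (t : ℂ) • ω₀ := by
  have hX : IsSmoothProjective (m + 1) A.X := Motives.isSmoothProjective_of_dim_eq' hA
  set hK := (d : ℂ) • complexBetti.map e.ι 2 a + complexBetti.map φ.hom.hom.hom 2 (complexBetti.map e.ι 2 a)
    with hKdef
  have hKrat : IsRationalClass hK := isRationalClass_ksymm d φ e ha
  -- `h_K = s • H'`, `H'` Kähler; Hodge–Riemann in degree one for `h_K^m = s^m H'^m`
  obtain ⟨s, H', hs0, hK', hh⟩ := exists_isKaehlerClass_ksymm_eq_smul hA hd φ e ha ha0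
  obtain ⟨τ, hτ⟩ := IsKaehlerClass.hodgeRiemann_one_smul (m := m) (X := A.X) hm hX hK' hs0
  rw [← hh] at hτ
  obtain ⟨τ', hτ'⟩ := exists_functional_degree_eq (show 1 + (1 + 2 * m) = 2 + 2 * m by omega) τ
  -- the line `H^{2m+2}` and a rational generator
  have h1 := Motives.finrank_complexBetti_two_add_two_mul_eq_one hX
  obtain ⟨ω₁, hωrat, hω0⟩ := Motives.exists_isRationalClass_ne_zero_two_add_two_mul hX
  have hline : ∀ c : complexBetti A.X (2 + 2 * m), ∃ r : ℂ, r • ω₁ = c :=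
    (finrank_eq_one_iff_of_nonzero' ω₁ hω0).1 h1
  have hωreal : conjClass (ComplexPoints A.X) (2 + 2 * m) ω₁ = ω₁ := hωrat.conjClass_eq
  -- Hodge–Riemann read on `Q(z, z̄)`; for real `x ≠ 0`: `Q(x, Cx) = c • ω₁`, `c` real, `c · τ'(ω₁) < 0`
  have key : ∀ x : complexBetti A.X 1, conjClass (ComplexPoints A.X) 1 x = x → x ≠ 0 →
      ∃ c : ℝ, polarizationPairingOne A.X hK m x (weilOperatorOne hX x) = (c : ℂ) • ω₁ ∧
        (τ' ω₁).im = 0 ∧ c * (τ' ω₁).re < 0 := by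
    intro x hxr hx0
    set z := projOneZero hX x with hzdef
    have hz : z ∈ hodgeOneZero hX := projOneZero_mem hX x
    have hz0 : z ≠ 0 := projOneZero_ne_zero_of_conjClass_eq hX hxr hx0
    -- Hodge–Riemann at `z`
    have hHR := hτ z ((mem_hodgeOneZero hX).1 hz) hz0
    rw [← hτ' z, ← polarizationPairingOne_eq_cupProduct_cupPowTwo] at hHR
    obtain ⟨r, hr⟩ := hline (polarizationPairingOne A.X hK m z (conjClass (ComplexPoints A.X) 1 z))
    rw [← hr, map_smul, smul_eq_mul] at hHR
    -- `Q(x, Cx) = (-2 i r) • ω₁`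
    have hQ : polarizationPairingOne A.X hK m x (weilOperatorOne hX x) = (-2 * Complex.I * r) • ω₁ := by
      rw [polarizationPairingOne_self_weilOperatorOne_of_conjClass_eq hX hK m hxr, ← hzdef, ← hr, smul_smul]
    -- the coefficient is real: `Q(x, Cx)` is a real class
    have hQreal : conjClass (ComplexPoints A.X) (2 + 2 * m)
        (polarizationPairingOne A.X hK m x (weilOperatorOne hX x)) =
        polarizationPairingOne A.X hK m x (weilOperatorOne hX x) := by
      rw [conjClass_polarizationPairingOne hKrat, hxr, conjClass_weilOperatorOne_of_conjClass_eq hX hxr]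
    have hcim : (-2 * Complex.I * r).im = 0 := im_eq_zero_of_smul_eq_of_conjClass_eq hQreal hωreal hω0 hQ
    refine ⟨(-2 * Complex.I * r).re, ?_, ?_, ?_⟩
    · rw [hQ]
      congr 1
      exact Complex.ext (by simp) (by rw [Complex.ofReal_im, hcim])
    · -- `r.re = 0` from `hcim`; then `(i r τ'ω₁).im = -r.im (τ'ω₁).im = 0` with `r.im ≠ 0`
      have hr0 : r.re = 0 := by
        have := hcim
        simp only [Complex.mul_im, Complex.mul_re, Complex.neg_re, Complex.neg_im, Complex.I_re,
          Complex.I_im, Complex.re_ofNat, Complex.im_ofNat] at this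
        linarith
      have h2 := hHR.2
      have h1' := hHR.1
      simp only [Complex.mul_im, Complex.mul_re, Complex.I_re, Complex.I_im, hr0] at h2 h1'
      have hri : r.im ≠ 0 := by
        intro h0
        rw [h0] at h1'
        simp at h1'
      have hprod : r.im * (τ' ω₁).im = 0 := by linarith
      exact (mul_eq_zero.1 hprod).resolve_left hri
    · have hr0 : r.re = 0 := by
        have := hcim
        simp only [Complex.mul_im, Complex.mul_re, Complex.neg_re, Complex.neg_im, Complex.I_re,
          Complex.I_im, Complex.re_ofNat, Complex.im_ofNat] at this
        linarith
      have h1' := hHR.1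
      simp only [Complex.mul_re, Complex.mul_im, Complex.I_re, Complex.I_im, hr0] at h1'
      simp only [Complex.mul_re, Complex.mul_im, Complex.neg_re, Complex.neg_im, Complex.I_re,
        Complex.I_im, Complex.re_ofNat, Complex.im_ofNat, hr0]
      linarith
  -- orient the generator
  by_cases hsign : (τ' ω₁).re < 0
  · refine ⟨ω₁, hωrat, hω0, fun x hxr hx0 ↦ ?_⟩
    obtain ⟨c, hc, -, hneg⟩ := key x hxr hx0
    refine ⟨c, ?_, hc⟩
    nlinarith
  · refine ⟨-ω₁, ?_, neg_ne_zero.2 hω0, fun x hxr hx0 ↦ ?_⟩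
    · have h := hωrat.smul (-1 : ℚ)
      rwa [Rat.cast_neg, Rat.cast_one, neg_one_smul] at h
    obtain ⟨c, hc, him, hneg⟩ := key x hxr hx0
    have hpos : 0 < (τ' ω₁).re := by
      rcases lt_trichotomy (τ' ω₁).re 0 with h | h | h
      · exact absurd h hsign
      · rw [h, mul_zero] at hneg; exact absurd hneg (lt_irrefl 0)
      · exact h
    refine ⟨-c, by nlinarith, ?_⟩
    rw [hc, Complex.ofReal_neg, smul_neg, neg_smul, neg_neg]

end WeilType

/-! ### The real form `H¹(X(ℂ); ℝ)`: `J = C|_ℝ`, `k = g^*|_ℝ`, `ψ = Re ℓ ∘ Q|_ℝ` -/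

section RealForm

variable {n : ℕ} {X : Motives.SchemeOver ℂ}

/-- **The Weil operator on the real cohomology `H¹(X(ℂ); ℝ)`**: `C` preserves real classes
(`conjClass_weilOperatorOne`), so `a ↦ re (C (a ⊗ 1))` is an `ℝ`-linear endomorphism of
`H¹(X(ℂ); ℝ)` whose complexification is `C` (`ofRealClass_realWeilOperatorOne`): the complex
structure of the real weight-one Hodge structure of `X` ([Deligne1982HodgeCycles, §1 and 4.7]:
`C` restricted to `V_ℝ`). [cite: Deligne1982HodgeCycles, §1 (p. 11) and 4.7] [cite: VoisinHodgeI2002, §6.1.3] -/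
def realWeilOperatorOne (hX : IsSmoothProjective n X) :
    singularCohomology ℝ ℝ (ComplexPoints X) 1 →ₗ[ℝ] singularCohomology ℝ ℝ (ComplexPoints X) 1 where
  toFun a := reClass (ComplexPoints X) 1 (weilOperatorOne hX (ofRealClass (ComplexPoints X) 1 a))
  map_add' a b := by rw [map_add, map_add, map_add]
  map_smul' r a := by rw [ofRealClass_smul, map_smul, reClass_real_smul, RingHom.id_apply]

/-- **`(J a) ⊗ 1 = C (a ⊗ 1)`**: the real Weil operator complexifies to the Weil operator.
[cite: Deligne1982HodgeCycles, §1 (p. 11)] -/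
theorem ofRealClass_realWeilOperatorOne (hX : IsSmoothProjective n X)
    (a : singularCohomology ℝ ℝ (ComplexPoints X) 1) :
    ofRealClass (ComplexPoints X) 1 (realWeilOperatorOne hX a) =
      weilOperatorOne hX (ofRealClass (ComplexPoints X) 1 a) :=
  ofRealClass_reClass_of_conjClass_eq
    (conjClass_weilOperatorOne_of_conjClass_eq hX (conjClass_ofRealClass a))

/-- **`J² = -1` on `H¹(X(ℂ); ℝ)`.** [cite: Deligne1982HodgeCycles, §1 (p. 11)] -/
theorem realWeilOperatorOne_realWeilOperatorOne (hX : IsSmoothProjective n X)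
    (a : singularCohomology ℝ ℝ (ComplexPoints X) 1) :
    realWeilOperatorOne hX (realWeilOperatorOne hX a) = -a := by
  apply ofRealClass_injective (Y := ComplexPoints X) 1
  rw [ofRealClass_realWeilOperatorOne, ofRealClass_realWeilOperatorOne, weilOperatorOne_weilOperatorOne,
    map_neg]

/-- **`J * J = -1`** in `End_ℝ H¹(X(ℂ); ℝ)`. [cite: Deligne1982HodgeCycles, §1 (p. 11)] -/
theorem realWeilOperatorOne_mul_self (hX : IsSmoothProjective n X) :
    realWeilOperatorOne hX * realWeilOperatorOne hX = -1 :=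
  LinearMap.ext fun a ↦ by
    rw [Module.End.mul_apply, realWeilOperatorOne_realWeilOperatorOne, LinearMap.neg_apply,
      Module.End.one_apply]

/-- **Pull-back `g^*` on the real cohomology `H¹(X(ℂ); ℝ)`** along an endomorphism `g : X ⟶ X`
(real coefficients; it complexifies to `complexBetti.map g 1`, `ofRealClass_realMapOne`).
[cite: HatcherAT2002, §3.1 p. 198] -/
def realMapOne (g : X ⟶ X) :
    singularCohomology ℝ ℝ (ComplexPoints X) 1 →ₗ[ℝ] singularCohomology ℝ ℝ (ComplexPoints X) 1 :=
  (singularCohomology.map ℝ ℝ (Motives.AlgPoints.mapContinuous (L := ℂ) g) 1).hom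

/-- `(g^* a) ⊗ 1 = g^* (a ⊗ 1)`. [cite: HatcherAT2002, §3.1 p. 198] -/
theorem ofRealClass_realMapOne (g : X ⟶ X) (a : singularCohomology ℝ ℝ (ComplexPoints X) 1) :
    ofRealClass (ComplexPoints X) 1 (realMapOne g a) = complexBetti.map g 1 (ofRealClass (ComplexPoints X) 1 a) :=
  ofRealClass_map _ a

/-- **`J` commutes with every `g^*`** on `H¹(X(ℂ); ℝ)` (`g^*` is a morphism of Hodge structures).
[cite: VoisinHodgeI2002, §7.3.2] -/
theorem realWeilOperatorOne_realMapOne (hX : IsSmoothProjective n X) (g : X ⟶ X)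
    (a : singularCohomology ℝ ℝ (ComplexPoints X) 1) :
    realWeilOperatorOne hX (realMapOne g a) = realMapOne g (realWeilOperatorOne hX a) := by
  apply ofRealClass_injective (Y := ComplexPoints X) 1
  rw [ofRealClass_realWeilOperatorOne, ofRealClass_realMapOne, ofRealClass_realMapOne,
    ofRealClass_realWeilOperatorOne, map_weilOperatorOne hX hX g]

/-- **`Commute J g^*`** in `End_ℝ H¹(X(ℂ); ℝ)`. [cite: VoisinHodgeI2002, §7.3.2] -/
theorem commute_realWeilOperatorOne_realMapOne (hX : IsSmoothProjective n X) (g : X ⟶ X) :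
    Commute (realWeilOperatorOne hX) (realMapOne g) :=
  LinearMap.ext fun a ↦ realWeilOperatorOne_realMapOne hX g a

/-- **`(φ^*)² = -d` on `H¹(A(ℂ); ℝ)`** for `φ ≫ φ = -d` (the tree's
`complexBetti_map_map_one_of_comp_self`, descended to real coefficients).
[cite: LangeBirkenhake1992, Prop. 1.1.9 and Lemma 1.1.17] -/
theorem realMapOne_realMapOne_of_comp_self {A : AbelianVariety ℂ} {d : ℕ} {φ : A ⟶ A}
    (hφ : φ ≫ φ = -(d • 𝟙 A)) (a : singularCohomology ℝ ℝ (ComplexPoints A.X) 1) :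
    realMapOne φ.hom.hom.hom (realMapOne φ.hom.hom.hom a) = -((d : ℝ) • a) := by
  apply ofRealClass_injective (Y := ComplexPoints A.X) 1
  rw [ofRealClass_realMapOne, ofRealClass_realMapOne, map_neg, ofRealClass_smul, Complex.ofReal_natCast]
  exact complexBetti_map_map_one_of_comp_self hφ _

/-- **`k * k = -d`** in `End_ℝ H¹(A(ℂ); ℝ)`, `k = φ^*` (the standing hypothesis `hk` of
`LinearAlgebra.QuadraticForm.PosComplexStructuresConnected`). [cite: LangeBirkenhake1992, Prop. 1.1.9] -/
theorem realMapOne_mul_self_of_comp_self {A : AbelianVariety ℂ} {d : ℕ} {φ : A ⟶ A}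
    (hφ : φ ≫ φ = -(d • 𝟙 A)) :
    realMapOne φ.hom.hom.hom * realMapOne φ.hom.hom.hom =
      -((d : ℝ) • (1 : Module.End ℝ (singularCohomology ℝ ℝ (ComplexPoints A.X) 1))) :=
  LinearMap.ext fun a ↦ by
    rw [Module.End.mul_apply, realMapOne_realMapOne_of_comp_self hφ, LinearMap.neg_apply,
      LinearMap.smul_apply, Module.End.one_apply]

/-- **The real polarization form `ψ_ℓ(a, b) = Re ℓ(Q_h(a ⊗ 1, b ⊗ 1))`** on `H¹(X(ℂ); ℝ)`, for a
class `h ∈ H²(X(ℂ); ℂ)`, an exponent `j` and a linear functional `ℓ` on `H^{2+2j}(X(ℂ); ℂ)` (for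
`dim X = j + 1` a line; with `ℓ` the coordinate along a rational generator, `ψ_ℓ` is rational on
the rational lattice, `exists_realPolarizationForm_lineCoord_eq_ratCast`).
[cite: Deligne1982HodgeCycles, proof of Thm. 4.8, p. 48] [cite: LangeBirkenhake1992, Lemma 1.1.17 and Thm. 4.2.1] -/
def realPolarizationForm (h : complexBetti X 2) (j : ℕ) (ℓ : complexBetti X (2 + 2 * j) →ₗ[ℂ] ℂ) :
    LinearMap.BilinForm ℝ (singularCohomology ℝ ℝ (ComplexPoints X) 1) :=
  LinearMap.mk₂ ℝ
    (fun a b ↦ (ℓ (polarizationPairingOne X h j (ofRealClass (ComplexPoints X) 1 a)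
      (ofRealClass (ComplexPoints X) 1 b))).re)
    (fun a a' b ↦ by simp only [map_add, LinearMap.add_apply, Complex.add_re])
    (fun r a b ↦ by
      simp only [ofRealClass_smul, map_smul, LinearMap.smul_apply, smul_eq_mul, Complex.re_ofReal_mul])
    (fun a b b' ↦ by simp only [map_add, Complex.add_re])
    (fun r a b ↦ by simp only [ofRealClass_smul, map_smul, smul_eq_mul, Complex.re_ofReal_mul])

/-- The defining formula of `realPolarizationForm`. [folklore] -/
theorem realPolarizationForm_apply (h : complexBetti X 2) (j : ℕ) (ℓ : complexBetti X (2 + 2 * j) →ₗ[ℂ] ℂ)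
    (a b : singularCohomology ℝ ℝ (ComplexPoints X) 1) :
    realPolarizationForm h j ℓ a b =
      (ℓ (polarizationPairingOne X h j (ofRealClass (ComplexPoints X) 1 a)
        (ofRealClass (ComplexPoints X) 1 b))).re :=
  rfl

/-- **`ψ_ℓ` is alternating** (`Q_h(x, x) = 0`; the standing hypothesis `hψ`). [cite: HatcherAT2002, Thm. 3.11] -/
theorem isAlt_realPolarizationForm (h : complexBetti X 2) (j : ℕ) (ℓ : complexBetti X (2 + 2 * j) →ₗ[ℂ] ℂ) :
    (realPolarizationForm h j ℓ).IsAlt := fun a ↦ by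
  rw [realPolarizationForm_apply, polarizationPairingOne_self, map_zero, Complex.zero_re]

/-- `ψ_ℓ(b, a) = -ψ_ℓ(a, b)`. [cite: HatcherAT2002, Thm. 3.11] -/
theorem realPolarizationForm_swap (h : complexBetti X 2) (j : ℕ) (ℓ : complexBetti X (2 + 2 * j) →ₗ[ℂ] ℂ)
    (a b : singularCohomology ℝ ℝ (ComplexPoints X) 1) :
    realPolarizationForm h j ℓ b a = -realPolarizationForm h j ℓ a b := by
  rw [realPolarizationForm_apply, realPolarizationForm_apply, polarizationPairingOne_swap, map_neg,
    Complex.neg_re]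

/-- **`ψ_ℓ(Ja, Jb) = ψ_ℓ(a, b)`** for `h` of type `(1,1)`, `dim X = j + 1` (Deligne's (b′)).
[cite: Deligne1982HodgeCycles, proof of Thm. 4.8, p. 48 (b′)] -/
theorem realPolarizationForm_realWeilOperatorOne {j : ℕ} (hX : IsSmoothProjective (j + 1) X)
    {h : complexBetti X 2} (hh : IsOfHodgeType (j + 1) X 2 1 1 h) (ℓ : complexBetti X (2 + 2 * j) →ₗ[ℂ] ℂ)
    (a b : singularCohomology ℝ ℝ (ComplexPoints X) 1) :
    realPolarizationForm h j ℓ (realWeilOperatorOne hX a) (realWeilOperatorOne hX b) =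
      realPolarizationForm h j ℓ a b := by
  rw [realPolarizationForm_apply, realPolarizationForm_apply, ofRealClass_realWeilOperatorOne,
    ofRealClass_realWeilOperatorOne, polarizationPairingOne_weilOperatorOne hX hh]

/-- **Rational classes have rational coordinates along a rational generator.**
[cite: HatcherAT2002, §3.1 Thm. 3.2 and p. 198] -/
theorem exists_lineCoord_eq_ratCast {k : ℕ} (h1 : Module.finrank ℂ (complexBetti X k) = 1)
    {ω₀ : complexBetti X k} (hω : IsRationalClass ω₀) (hω0 : ω₀ ≠ 0) {c : complexBetti X k}
    (hc : IsRationalClass c) : ∃ q : ℚ, lineCoord ω₀ hω0 h1 c = (q : ℂ) := by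
  obtain ⟨q, rfl⟩ := Motives.exists_eq_ratCast_smul_of_finrank_eq_one h1 hω hω0 hc
  exact ⟨q, lineCoord_apply_smul _ _ _ _⟩

/-- **The Riemann form is rational on the rational lattice**: for rational `h`, a rational generator
`ω₀` (with the tree's coordinate functional `lineCoord`, `HodgeRiemannPolarizabilityProofs`) and real
classes `a, b` with rational complexifications, `ψ(a, b) ∈ ℚ` (`Q_h` of rational classes is rational,
`Motives.isRationalClass_polarizationPairingOne`).
[cite: vanGeemen1994HodgeAV, 4.8 and Lemma 5.2 (2)] [cite: LangeBirkenhake1992, Lemma 1.1.17] -/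
theorem exists_realPolarizationForm_lineCoord_eq_ratCast {j : ℕ}
    (h1 : Module.finrank ℂ (complexBetti X (2 + 2 * j)) = 1) {h : complexBetti X 2} (hh : IsRationalClass h)
    {ω₀ : complexBetti X (2 + 2 * j)} (hω : IsRationalClass ω₀) (hω0 : ω₀ ≠ 0)
    {a b : singularCohomology ℝ ℝ (ComplexPoints X) 1}
    (ha : IsRationalClass (ofRealClass (ComplexPoints X) 1 a)) (hb : IsRationalClass (ofRealClass (ComplexPoints X) 1 b)) :
    ∃ q : ℚ, realPolarizationForm h j (lineCoord ω₀ hω0 h1) a b = q := by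
  obtain ⟨q, hq⟩ := exists_lineCoord_eq_ratCast h1 hω hω0
    (Motives.isRationalClass_polarizationPairingOne hh j ha hb)
  exact ⟨q, by rw [realPolarizationForm_apply, hq, Complex.ratCast_re]⟩

end RealForm

/-! ### The period point of `(A, φ, h_K)`: the `X⁺` package on `H¹(A(ℂ); ℝ)` -/

section PeriodPoint

variable {m d : ℕ} {A : AbelianVariety ℂ}

/-- **`ψ(Ja, Jb) = ψ(a, b)` for the period point of `(A, φ, h_K)`** (any functional `ℓ`).
[cite: Deligne1982HodgeCycles, proof of Thm. 4.8, p. 48 (b′)] [cite: vanGeemen1994HodgeAV, Lemma 5.2 (1)] -/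
theorem realPolarizationForm_realWeilOperatorOne_ksymm (hA : A.dim = m + 1) (hd : 0 < d) (φ : A ⟶ A)
    (e : ProjectiveEmbedding A.X) {a : complexBetti (projectiveSpace e.n ℂ) 2} (ha : IsRationalClass a)
    (ha0 : a ≠ 0) (ℓ : complexBetti A.X (2 + 2 * m) →ₗ[ℂ] ℂ) (x y : singularCohomology ℝ ℝ (ComplexPoints A.X) 1) :
    realPolarizationForm
        ((d : ℂ) • complexBetti.map e.ι 2 a + complexBetti.map φ.hom.hom.hom 2 (complexBetti.map e.ι 2 a)) m ℓ
        (realWeilOperatorOne (Motives.isSmoothProjective_of_dim_eq' hA) x)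
        (realWeilOperatorOne (Motives.isSmoothProjective_of_dim_eq' hA) y) =
      realPolarizationForm
        ((d : ℂ) • complexBetti.map e.ι 2 a + complexBetti.map φ.hom.hom.hom 2 (complexBetti.map e.ι 2 a)) m ℓ
        x y :=
  realPolarizationForm_realWeilOperatorOne (Motives.isSmoothProjective_of_dim_eq' hA)
    (isOfHodgeType_one_one_ksymm hA hd φ e ha ha0) ℓ x y

/-- **`ψ(ka, kb) = d · ψ(a, b)`, `k = φ^*`,** for the period point of `(A, φ, h_K)`, `φ ≫ φ = -d`
(van Geemen's `(√-d)^* E = d E`; any functional `ℓ`). [cite: vanGeemen1994HodgeAV, 4.9 and Lemma 5.2 (2)] -/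
theorem realPolarizationForm_realMapOne_realMapOne_ksymm (hA : A.dim = m + 1) (hd : 0 < d) {φ : A ⟶ A}
    (hφ : φ ≫ φ = -(d • 𝟙 A)) (e : ProjectiveEmbedding A.X) (a : complexBetti (projectiveSpace e.n ℂ) 2)
    (ℓ : complexBetti A.X (2 + 2 * m) →ₗ[ℂ] ℂ) (x y : singularCohomology ℝ ℝ (ComplexPoints A.X) 1) :
    realPolarizationForm
        ((d : ℂ) • complexBetti.map e.ι 2 a + complexBetti.map φ.hom.hom.hom 2 (complexBetti.map e.ι 2 a)) m ℓ
        (realMapOne φ.hom.hom.hom x) (realMapOne φ.hom.hom.hom y) =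
      d * realPolarizationForm
        ((d : ℂ) • complexBetti.map e.ι 2 a + complexBetti.map φ.hom.hom.hom 2 (complexBetti.map e.ι 2 a)) m ℓ
        x y := by
  rw [realPolarizationForm_apply, realPolarizationForm_apply, ofRealClass_realMapOne, ofRealClass_realMapOne,
    polarizationPairingOne_map_map_ksymm hA hd hφ e a, map_smul, smul_eq_mul, Complex.mul_re,
    Complex.natCast_re, Complex.natCast_im, zero_mul, sub_zero]

/-- **`ψ(ka, b) = -ψ(a, kb)`, `k = φ^*`,** for the period point of `(A, φ, h_K)` (the standing
hypothesis `hψk` of `PosComplexStructuresConnected`; any functional `ℓ`).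
[cite: vanGeemen1994HodgeAV, 4.9 and Lemma 5.2 (2)] [cite: Deligne1982HodgeCycles, proof of Thm. 4.8, p. 48 (a′)] -/
theorem realPolarizationForm_realMapOne_left_ksymm (hA : A.dim = m + 1) (hd : 0 < d) {φ : A ⟶ A}
    (hφ : φ ≫ φ = -(d • 𝟙 A)) (e : ProjectiveEmbedding A.X) (a : complexBetti (projectiveSpace e.n ℂ) 2)
    (ℓ : complexBetti A.X (2 + 2 * m) →ₗ[ℂ] ℂ) (x y : singularCohomology ℝ ℝ (ComplexPoints A.X) 1) :
    realPolarizationForm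
        ((d : ℂ) • complexBetti.map e.ι 2 a + complexBetti.map φ.hom.hom.hom 2 (complexBetti.map e.ι 2 a)) m ℓ
        (realMapOne φ.hom.hom.hom x) y =
      -realPolarizationForm
        ((d : ℂ) • complexBetti.map e.ι 2 a + complexBetti.map φ.hom.hom.hom 2 (complexBetti.map e.ι 2 a)) m ℓ
        x (realMapOne φ.hom.hom.hom y) := by
  rw [realPolarizationForm_apply, realPolarizationForm_apply, ofRealClass_realMapOne, ofRealClass_realMapOne,
    polarizationPairingOne_map_left_ksymm hA hd hφ e a, map_neg, Complex.neg_re]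

/-- **Positivity `ψ(x, Jx) > 0` for the period point of `(A, φ, h_K)`** on `H¹(A(ℂ); ℝ) ∖ 0`, for
every functional `ℓ` positive on the oriented rational generator `ω₀` of `H^{2m+2}(A(ℂ); ℂ)` of
`exists_pos_polarizationPairingOne_weilOperatorOne` (e.g. its coordinate `lineCoord`, `ℓ(ω₀) = 1`):
the second Riemann condition `E(x, Jx) > 0` (van Geemen) / "`ψ(x, Jy)` positive definite" (Deligne)
for `dim A = m + 1 ≥ 2`. [cite: Deligne1982HodgeCycles, proof of Thm. 4.8, p. 48]
[cite: vanGeemen1994HodgeAV, proof of Lemma 5.2 (p. 221)] [cite: VoisinHodgeI2002, Thm. 6.32] -/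
theorem exists_pos_realPolarizationForm_realWeilOperatorOne (hm : 1 ≤ m) (hA : A.dim = m + 1) (hd : 0 < d)
    (φ : A ⟶ A) (e : ProjectiveEmbedding A.X) {a : complexBetti (projectiveSpace e.n ℂ) 2}
    (ha : IsRationalClass a) (ha0 : a ≠ 0) :
    ∃ ω₀ : complexBetti A.X (2 + 2 * m), IsRationalClass ω₀ ∧ ω₀ ≠ 0 ∧
      ∀ ℓ : complexBetti A.X (2 + 2 * m) →ₗ[ℂ] ℂ, 0 < (ℓ ω₀).re →
        ∀ x : singularCohomology ℝ ℝ (ComplexPoints A.X) 1, x ≠ 0 →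
          0 < realPolarizationForm
            ((d : ℂ) • complexBetti.map e.ι 2 a + complexBetti.map φ.hom.hom.hom 2 (complexBetti.map e.ι 2 a)) m ℓ
            x (realWeilOperatorOne (Motives.isSmoothProjective_of_dim_eq' hA) x) := by
  obtain ⟨ω₀, hωrat, hω0, hpos⟩ := exists_pos_polarizationPairingOne_weilOperatorOne hm hA hd φ e ha ha0
  refine ⟨ω₀, hωrat, hω0, fun ℓ hℓ x hx0 ↦ ?_⟩
  have hxr : conjClass (ComplexPoints A.X) 1 (ofRealClass (ComplexPoints A.X) 1 x) =
      ofRealClass (ComplexPoints A.X) 1 x := conjClass_ofRealClass x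
  have hx0' : ofRealClass (ComplexPoints A.X) 1 x ≠ 0 := fun h0 ↦ hx0 (ofRealClass_injective (Y := ComplexPoints A.X) 1
    (by rw [h0, map_zero]))
  obtain ⟨t, ht, hQ⟩ := hpos _ hxr hx0'
  rw [realPolarizationForm_apply, ofRealClass_realWeilOperatorOne, hQ, map_smul, smul_eq_mul,
    Complex.re_ofReal_mul]
  exact mul_pos ht hℓ

/-- The coordinate `lineCoord` along the oriented generator is an admissible `ℓ` (`ℓ(ω₀) = 1 > 0`),
so **`ψ(x, Jx) > 0` for the RATIONAL Riemann form `ψ = lineCoord ∘ Q_{h_K}`** of the period point.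
[cite: Deligne1982HodgeCycles, proof of Thm. 4.8, p. 48] [cite: vanGeemen1994HodgeAV, proof of Lemma 5.2 (p. 221)] -/
theorem exists_pos_realPolarizationForm_lineCoord (hm : 1 ≤ m) (hA : A.dim = m + 1) (hd : 0 < d)
    (φ : A ⟶ A) (e : ProjectiveEmbedding A.X) {a : complexBetti (projectiveSpace e.n ℂ) 2}
    (ha : IsRationalClass a) (ha0 : a ≠ 0) :
    ∃ (ω₀ : complexBetti A.X (2 + 2 * m)) (hω0 : ω₀ ≠ 0), IsRationalClass ω₀ ∧
      ∀ x : singularCohomology ℝ ℝ (ComplexPoints A.X) 1, x ≠ 0 →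
        0 < realPolarizationForm
          ((d : ℂ) • complexBetti.map e.ι 2 a + complexBetti.map φ.hom.hom.hom 2 (complexBetti.map e.ι 2 a)) m
          (lineCoord ω₀ hω0
            (Motives.finrank_complexBetti_two_add_two_mul_eq_one (Motives.isSmoothProjective_of_dim_eq' hA)))
          x (realWeilOperatorOne (Motives.isSmoothProjective_of_dim_eq' hA) x) := by
  obtain ⟨ω₀, hωrat, hω0, hpos⟩ := exists_pos_realPolarizationForm_realWeilOperatorOne hm hA hd φ e ha ha0
  refine ⟨ω₀, hω0, hωrat, fun x hx0 ↦ hpos _ ?_ x hx0⟩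
  rw [lineCoord_self, Complex.one_re]
  exact one_pos

end PeriodPoint

/-! ### Normed models: the period point as a member of `posComplexStructures` -/

section NormedModel

open Literature.LinearAlgebra.QuadraticForm

variable {V : Type*} [AddCommGroup V] [Module ℝ V]
variable {W : Type*} [NormedAddCommGroup W] [NormedSpace ℝ W] [FiniteDimensional ℝ W]

/-- **Transport of an endomorphism of `V` to a finite-dimensional normed model `g : W ≃ V`**, as a
continuous linear map `g⁻¹ T g` (`posComplexStructures` lives on continuous endomorphisms of a
normed space; every finite-dimensional real vector space — e.g. `H¹(A(ℂ); ℝ)` through a basis —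
has such models). [folklore] -/
def transportEnd (g : W ≃ₗ[ℝ] V) (T : V →ₗ[ℝ] V) : W →L[ℝ] W :=
  LinearMap.toContinuousLinearMap (g.symm.toLinearMap ∘ₗ T ∘ₗ g.toLinearMap)

/-- `(g⁻¹ T g) w = g⁻¹ (T (g w))`. [folklore] -/
@[simp]
theorem transportEnd_apply (g : W ≃ₗ[ℝ] V) (T : V →ₗ[ℝ] V) (w : W) : transportEnd g T w = g.symm (T (g w)) :=
  rfl

/-- **Transport of the `X⁺` package.** If `J, k ∈ End V` and `ψ` satisfy `J² = -1`, `Jk = kJ`,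
`ψ(Jx, Jy) = ψ(x, y)`, `ψ(x, Jx) > 0` (`x ≠ 0`), then on any normed model `g : W ≃ V` the transported
`g⁻¹ J g` lies in `posComplexStructures (g⁻¹ k g) (ψ ∘ (g × g))`. [cite: Deligne1982HodgeCycles, proof of Thm. 4.8, pp. 48–49] -/
theorem transportEnd_mem_posComplexStructures (g : W ≃ₗ[ℝ] V) {J k : V →ₗ[ℝ] V} {ψ : LinearMap.BilinForm ℝ V}
    (hJ : ∀ v, J (J v) = -v) (hJk : ∀ v, J (k v) = k (J v)) (hψJ : ∀ x y, ψ (J x) (J y) = ψ x y)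
    (hpos : ∀ x, x ≠ 0 → 0 < ψ x (J x)) :
    transportEnd g J ∈ posComplexStructures (transportEnd g k) (ψ.compl₁₂ g.toLinearMap g.toLinearMap) := by
  refine ⟨?_, ?_, ?_, ?_⟩
  · ext w
    simp [hJ]
  · ext w
    simp [hJk]
  · intro x y
    simp [hψJ]
  · intro x hx
    have hgx : g x ≠ 0 := fun h0 ↦ hx (g.map_eq_zero_iff.1 h0)
    simpa using hpos _ hgx

/-- **Transport of the standing hypotheses** `k² = -d`, `ψ(kx, y) = -ψ(x, ky)`, `ψ` alternating to a
normed model. [folklore] -/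
theorem transportEnd_standing (g : W ≃ₗ[ℝ] V) {k : V →ₗ[ℝ] V} {ψ : LinearMap.BilinForm ℝ V} {d : ℝ}
    (hk : ∀ v, k (k v) = -(d • v)) (hψk : ∀ x y, ψ (k x) y = -ψ x (k y)) (hψ : ψ.IsAlt) :
    transportEnd g k * transportEnd g k = -(d • (1 : W →L[ℝ] W)) ∧
    (∀ x y, ψ.compl₁₂ g.toLinearMap g.toLinearMap (transportEnd g k x) y =
      -ψ.compl₁₂ g.toLinearMap g.toLinearMap x (transportEnd g k y)) ∧
    (ψ.compl₁₂ g.toLinearMap g.toLinearMap).IsAlt := by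
  refine ⟨?_, fun x y ↦ ?_, fun x ↦ ?_⟩
  · ext w
    simp [hk]
  · simp [hψk]
  · simpa using hψ (g x)

variable {m d : ℕ} {A : AbelianVariety ℂ}

/-- **The period point of an abelian variety of Weil type with a `K`-compatible polarization lies in
Deligne's `X⁺`.** Let `A` be a complex abelian variety of dimension `m + 1 ≥ 2`, `φ ≫ φ = -d`
(`d ≥ 1`), `e` a projective embedding, `a ∈ H²(ℙᴺ(ℂ); ℂ)` rational non-zero,
`h_K = d·e^*a + φ^*e^*a`; `V = H¹(A(ℂ); ℝ)` with `J` the Weil operator, `k = φ^*`, and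
`ψ = Re ℓ ∘ Q_{h_K}`. There is a non-zero rational generator `ω₀` of `H^{2m+2}(A(ℂ); ℂ)` such that
for EVERY functional `ℓ` with `Re ℓ(ω₀) > 0` and EVERY finite-dimensional normed model
`g : W ≃ V`: the transported `J` is a member of
`posComplexStructures (g⁻¹ k g) (ψ ∘ (g × g))` (`J² = -1`, `Jk = kJ`, `ψ(Jx, Jy) = ψ(x, y)`,
`ψ(x, Jx) > 0`), and the standing hypotheses of `PosComplexStructuresConnected` hold:
`(g⁻¹ k g)² = -d`, `ψ(kx, y) = -ψ(x, ky)`, `ψ` alternating. This is "the complex structure of `A`"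
as a point of `X⁺` in the proof of Deligne's Thm. 4.8 (p. 48), on the tree's carriers.
[cite: Deligne1982HodgeCycles, proof of Thm. 4.8, pp. 48–49 ((a′), (b′), X⁺)]
[cite: vanGeemen1994HodgeAV, 4.9 and Lemma 5.2 (1)–(2) with proof (p. 221)] [cite: VoisinHodgeI2002, Thm. 6.32] -/
theorem periodPoint_mem_posComplexStructures (hm : 1 ≤ m) (hA : A.dim = m + 1) (hd : 0 < d) {φ : A ⟶ A}
    (hφ : φ ≫ φ = -(d • 𝟙 A)) (e : ProjectiveEmbedding A.X) {a : complexBetti (projectiveSpace e.n ℂ) 2}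
    (ha : IsRationalClass a) (ha0 : a ≠ 0) :
    ∃ ω₀ : complexBetti A.X (2 + 2 * m), IsRationalClass ω₀ ∧ ω₀ ≠ 0 ∧
      ∀ ℓ : complexBetti A.X (2 + 2 * m) →ₗ[ℂ] ℂ, 0 < (ℓ ω₀).re →
        ∀ g : W ≃ₗ[ℝ] singularCohomology ℝ ℝ (ComplexPoints A.X) 1,
          transportEnd g (realWeilOperatorOne (Motives.isSmoothProjective_of_dim_eq' hA)) ∈
            posComplexStructures (transportEnd g (realMapOne φ.hom.hom.hom))
              ((realPolarizationForm ((d : ℂ) • complexBetti.map e.ι 2 a +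
                  complexBetti.map φ.hom.hom.hom 2 (complexBetti.map e.ι 2 a)) m ℓ).compl₁₂
                g.toLinearMap g.toLinearMap) ∧
          transportEnd g (realMapOne φ.hom.hom.hom) * transportEnd g (realMapOne φ.hom.hom.hom) =
            -((d : ℝ) • (1 : W →L[ℝ] W)) ∧
          (∀ x y, (realPolarizationForm ((d : ℂ) • complexBetti.map e.ι 2 a +
                complexBetti.map φ.hom.hom.hom 2 (complexBetti.map e.ι 2 a)) m ℓ).compl₁₂ g.toLinearMap g.toLinearMap
              (transportEnd g (realMapOne φ.hom.hom.hom) x) y =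
            -(realPolarizationForm ((d : ℂ) • complexBetti.map e.ι 2 a +
                complexBetti.map φ.hom.hom.hom 2 (complexBetti.map e.ι 2 a)) m ℓ).compl₁₂ g.toLinearMap g.toLinearMap
              x (transportEnd g (realMapOne φ.hom.hom.hom) y)) ∧
          ((realPolarizationForm ((d : ℂ) • complexBetti.map e.ι 2 a +
              complexBetti.map φ.hom.hom.hom 2 (complexBetti.map e.ι 2 a)) m ℓ).compl₁₂
            g.toLinearMap g.toLinearMap).IsAlt := by
  obtain ⟨ω₀, hωrat, hω0, hpos⟩ := exists_pos_realPolarizationForm_realWeilOperatorOne hm hA hd φ e ha ha0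
  refine ⟨ω₀, hωrat, hω0, fun ℓ hℓ g ↦ ⟨?_, ?_⟩⟩
  · exact transportEnd_mem_posComplexStructures g
      (realWeilOperatorOne_realWeilOperatorOne (Motives.isSmoothProjective_of_dim_eq' hA))
      (fun v ↦ realWeilOperatorOne_realMapOne (Motives.isSmoothProjective_of_dim_eq' hA) φ.hom.hom.hom v)
      (realPolarizationForm_realWeilOperatorOne_ksymm hA hd φ e ha ha0 ℓ) (hpos ℓ hℓ)
  · exact transportEnd_standing g (realMapOne_realMapOne_of_comp_self hφ)
      (realPolarizationForm_realMapOne_left_ksymm hA hd hφ e a ℓ)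
      (isAlt_realPolarizationForm _ m ℓ)

end NormedModel

end HodgeTheory

end Literature.AlgebraicGeometry.HodgeTheory

end
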